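import Literature.AlgebraicGeometry.Frobenioids.CoproductCompletionConnected
import Mathlib.CategoryTheory.Limits.Constructions.FiniteProductsOfBinaryProducts
import HarnessLib

/-!
# Frobenioids I, §0: `C^⊥` is a category of finitely connected type (§0 residual of the STEP-0
# fragment; abc-iut cell, layer L1)

Mochizuki, *The geometry of Frobenioids I: the general theory*, Kyushu J. Math. **62** (2008)
293–400, §0 "Categories", kurims text p. 16 [cite: MochizukiFrdI2008, §0 p.16]:

> "Thus, `C^⊥` (respectively, `C^⊤`) is a category of finitely (respectively, countably)
> connected type."

We verify the three clauses of "of finitely connected type" (FrdI §0 p. 15,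
`IsOfFinitelyConnectedType`) for `C^⊥ = FiniteCoproductCompletion C`: finite coproducts exist; every
object is the coproduct of its (finitely many, connected) one-index components; and for a colimit
cofan `∐ Xᵢ` and a connected `B` the map `∐ᵢ Hom(B, Xᵢ) → Hom(B, ∐ Xᵢ)` is bijective (computed on
the explicit cofan, whose `Hom` is the printed formula, and transported along the comparison
isomorphism). The countable case `C^⊤` is left as a statement-level remark (same proof with
countable index families; not needed downstream so far). No statement of the paper is strengthened.
-/

namespace Literature.AlgebraicGeometry.Frobenioids

open CategoryTheory Limits

universe w v u

variable {C : Type u} [Category.{v} C]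

namespace CoproductCompletion

variable {P : ObjectProperty (FormalCoproduct.{w} C)}

/-! ### Coproducts of families indexed by a small type -/

/-- The formal coproduct `∐ᵢ Fᵢ` of a family (index set the `Σ`-type). [cite: MochizukiFrdI2008, §0 p.16] -/
def sigma {ι : Type} (F : ι → FormalCoproduct.{w} C) : FormalCoproduct.{w} C :=
  ⟨Σ i, (F i).I, fun p => (F p.1).obj p.2⟩

/-- The coprojections `Fᵢ → ∐ᵢ Fᵢ`. [cite: MochizukiFrdI2008, §0 p.16] -/
def sigmaInj {ι : Type} (F : ι → FormalCoproduct.{w} C) (i : ι) : F i ⟶ sigma F :=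
  ⟨fun x => ⟨i, x⟩, fun x => 𝟙 ((F i).obj x)⟩

/-- The map out of `∐ᵢ Fᵢ` determined by maps out of the `Fᵢ`. [cite: MochizukiFrdI2008, §0 p.16] -/
def sigmaDesc {ι : Type} {F : ι → FormalCoproduct.{w} C} {Z : FormalCoproduct.{w} C}
    (g : ∀ i, F i ⟶ Z) : sigma F ⟶ Z :=
  ⟨fun p => (g p.1).f p.2, fun p => (g p.1).φ p.2⟩

/-- `(Fᵢ → ∐ Fᵢ → Z) = gᵢ`. [cite: MochizukiFrdI2008, §0 p.16] -/
theorem sigmaInj_sigmaDesc {ι : Type} {F : ι → FormalCoproduct.{w} C} {Z : FormalCoproduct.{w} C}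
    (g : ∀ i, F i ⟶ Z) (i : ι) : sigmaInj F i ≫ sigmaDesc g = g i :=
  FormalCoproduct.hom_ext rfl fun x => by
    show (𝟙 _ ≫ (g i).φ x) ≫ eqToHom rfl = (g i).φ x
    rw [Category.id_comp, eqToHom_refl, Category.comp_id]

/-- Uniqueness of maps out of `∐ Fᵢ`. [cite: MochizukiFrdI2008, §0 p.16] -/
theorem sigmaDesc_unique {ι : Type} {F : ι → FormalCoproduct.{w} C} {Z : FormalCoproduct.{w} C}
    (m : sigma F ⟶ Z) : m = sigmaDesc fun i => sigmaInj F i ≫ m :=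
  FormalCoproduct.hom_ext rfl fun p => by
    obtain ⟨i, x⟩ := p
    show m.φ ⟨i, x⟩ ≫ eqToHom _ = 𝟙 _ ≫ m.φ ⟨i, x⟩
    rw [eqToHom_refl, Category.comp_id, Category.id_comp]

/-- The cofan `∐ᵢ Fᵢ` inside a full subcategory containing it. [cite: MochizukiFrdI2008, §0 p.16] -/
def sigmaCofanSub {ι : Type} (F : ι → P.FullSubcategory) (hS : P (sigma fun i => (F i).obj)) : Cofan F :=
  Cofan.mk ⟨sigma fun i => (F i).obj, hS⟩ fun i => ObjectProperty.homMk (sigmaInj (fun i => (F i).obj) i)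

/-- It is a colimit cofan. [cite: MochizukiFrdI2008, §0 p.16] -/
def sigmaCofanSubIsColimit {ι : Type} (F : ι → P.FullSubcategory) (hS : P (sigma fun i => (F i).obj)) :
    IsColimit (sigmaCofanSub F hS) :=
  Cofan.IsColimit.mk _ (fun s => ObjectProperty.homMk (sigmaDesc fun i => (s.inj i).hom))
    (fun s i => ObjectProperty.hom_ext _ (sigmaInj_sigmaDesc (fun i => (s.inj i).hom) i))
    (fun s m hm => ObjectProperty.hom_ext _ (by
      show m.hom = sigmaDesc fun i => (s.inj i).hom
      rw [sigmaDesc_unique m.hom]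
      congr 1
      funext i
      exact congrArg InducedCategory.Hom.hom (hm i)))

/-! ### Maps out of a one-index object into `∐ Fᵢ` -/

/-- For `B` with a single index and the explicit cofan `∐ Fᵢ`: the map
`∐ᵢ Hom(B, Fᵢ) → Hom(B, ∐ Fᵢ)` is bijective (the `Hom` of formal coproducts is the printed
formula `Hom(∐ Aᵢ, ∐ Bⱼ) = ∏ᵢ ∐ⱼ Hom(Aᵢ, Bⱼ)`). [cite: MochizukiFrdI2008, §0 p.16] -/
theorem bijective_sigmaCofanSub {ι : Type} (F : ι → P.FullSubcategory) (hS : P (sigma fun i => (F i).obj))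
    (B : P.FullSubcategory) [Unique B.obj.I] :
    Function.Bijective fun p : Σ i, (B ⟶ F i) => p.2 ≫ (sigmaCofanSub F hS).inj p.1 := by
  -- explicit inverse
  let inv : (B ⟶ (sigmaCofanSub F hS).pt) → Σ i, (B ⟶ F i) := fun h =>
    ⟨(h.hom.f default).1, ObjectProperty.homMk
      ⟨fun _ => (h.hom.f default).2,
        fun b => eqToHom (congrArg B.obj.obj (Unique.eq_default b)) ≫ h.hom.φ default⟩⟩
  refine Function.bijective_iff_has_inverse.mpr ⟨inv, fun p => ?_, fun h => ?_⟩
  · -- left inverse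
    obtain ⟨i, g⟩ := p
    refine Sigma.ext rfl (heq_of_eq ?_)
    refine ObjectProperty.hom_ext _ (FormalCoproduct.hom_ext (funext fun b => ?_) fun b => ?_)
    · show g.hom.f default = g.hom.f b
      rw [Unique.eq_default b]
    · revert b
      refine Unique.forall_iff.mpr ?_
      show (eqToHom _ ≫ g.hom.φ default ≫ 𝟙 _) ≫ eqToHom _ = g.hom.φ default
      simp only [eqToHom_refl, Category.id_comp, Category.comp_id]
  · -- right inverse
    refine ObjectProperty.hom_ext _ (FormalCoproduct.hom_ext (funext fun b => ?_) fun b => ?_)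
    · show (⟨(h.hom.f default).1, (h.hom.f default).2⟩ : Σ i, (F i).obj.I) = h.hom.f b
      have hb : b = default := Unique.eq_default b
      rw [hb]
      exact Sigma.eta _
    · revert b
      refine Unique.forall_iff.mpr ?_
      show ((eqToHom _ ≫ h.hom.φ default) ≫ 𝟙 _) ≫ eqToHom _ = h.hom.φ default
      simp only [eqToHom_refl, Category.id_comp, Category.comp_id]

/-- For any colimit cofan of a family in the subcategory and any one-index `B`,
`∐ᵢ Hom(B, Fᵢ) → Hom(B, ∐ Fᵢ)` is bijective (transport along the comparison isomorphism with
the explicit cofan). [cite: MochizukiFrdI2008, §0 p.16] -/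
theorem bijective_of_isColimit {ι : Type} {F : ι → P.FullSubcategory} (hS : P (sigma fun i => (F i).obj))
    (c : Cofan F) (hc : IsColimit c) (B : P.FullSubcategory) [Unique B.obj.I] :
    Function.Bijective fun p : Σ i, (B ⟶ F i) => p.2 ≫ c.inj p.1 := by
  let φ : (sigmaCofanSub F hS).pt ≅ c.pt := (sigmaCofanSubIsColimit F hS).coconePointUniqueUpToIso hc
  have hφ : ∀ i, (sigmaCofanSub F hS).inj i ≫ φ.hom = c.inj i := fun i =>
    (sigmaCofanSubIsColimit F hS).comp_coconePointUniqueUpToIso_hom hc ⟨i⟩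
  have key : (fun p : Σ i, (B ⟶ F i) => p.2 ≫ c.inj p.1) =
      (fun h => h ≫ φ.hom) ∘ fun p : Σ i, (B ⟶ F i) => p.2 ≫ (sigmaCofanSub F hS).inj p.1 := by
    funext p
    show p.2 ≫ c.inj p.1 = (p.2 ≫ (sigmaCofanSub F hS).inj p.1) ≫ φ.hom
    rw [Category.assoc, hφ]
  rw [key]
  refine Function.Bijective.comp ?_ (bijective_sigmaCofanSub F hS B)
  refine Function.bijective_iff_has_inverse.mpr ⟨fun h => h ≫ φ.inv, fun h => ?_, fun h => ?_⟩
  · show (h ≫ φ.hom) ≫ φ.inv = h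
    rw [Category.assoc, Iso.hom_inv_id, Category.comp_id]
  · show (h ≫ φ.inv) ≫ φ.hom = h
    rw [Category.assoc, Iso.inv_hom_id, Category.comp_id]

end CoproductCompletion

open CoproductCompletion

/-! ### `C^⊥` is of finitely connected type -/

/-- `C^⊥` has an initial object (the empty formal coproduct). [cite: MochizukiFrdI2008, §0 p.16] -/
theorem hasInitial_finiteCoproductCompletion : HasInitial (FiniteCoproductCompletion.{w} C) := by
  let E : FiniteCoproductCompletion.{w} C := ⟨empty, show Finite PEmpty.{w + 1} from inferInstance⟩
  haveI : IsEmpty E.obj.I := show IsEmpty PEmpty.{w + 1} from inferInstance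
  exact (CoproductCompletion.isInitialOfIsEmpty E).hasInitial

/-- `C^⊥` has finite coproducts. [cite: MochizukiFrdI2008, §0 p.16] -/
theorem hasFiniteCoproducts_finiteCoproductCompletion : HasFiniteCoproducts (FiniteCoproductCompletion.{w} C) := by
  haveI : ∀ X Y : FiniteCoproductCompletion.{w} C, HasBinaryCoproduct X Y :=
    hasBinaryCoproduct_finiteCoproductCompletion
  haveI : HasBinaryCoproducts (FiniteCoproductCompletion.{w} C) := hasBinaryCoproducts_of_hasColimit_pair _
  haveI := hasInitial_finiteCoproductCompletion (C := C)
  exact hasFiniteCoproducts_of_has_binary_and_initial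

/-- Every object of `C^⊥` is a finite coproduct of (connected) one-point objects `incl (X i)`.
[cite: MochizukiFrdI2008, §0 p.16] -/
theorem exists_cofan_finiteCoproductCompletion (X : FiniteCoproductCompletion.{w} C) :
    ∃ (n : ℕ) (F : Fin n → FiniteCoproductCompletion.{w} C), (∀ i, IsConnectedObj (F i)) ∧
      ∃ c : Cofan F, Nonempty (IsColimit c) ∧ Nonempty (c.pt ≅ X) := by
  haveI : Finite X.obj.I := X.property
  obtain ⟨n, ⟨e⟩⟩ := Finite.exists_equiv_fin X.obj.I
  let F : Fin n → FiniteCoproductCompletion.{w} C := fun k =>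
    (toFiniteCoproductCompletion.{w} C).obj (X.obj.obj (e.symm k))
  have hS : finiteFormalCoproducts.{w} C (sigma fun k => (F k).obj) :=
    show Finite (Σ _ : Fin n, PUnit.{w + 1}) from inferInstance
  refine ⟨n, F, fun k => isConnectedObj_toFiniteCoproductCompletion _, sigmaCofanSub F hS,
    ⟨sigmaCofanSubIsColimit F hS⟩, ⟨(finiteFormalCoproducts.{w} C).isoMk ?_⟩⟩
  -- `∐ₖ incl (X (e⁻¹ k)) ≅ X` in `FormalCoproduct C`
  let e' : (Σ _ : Fin n, PUnit.{w + 1}) ≃ X.obj.I :=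
    { toFun := fun p => e.symm p.1
      invFun := fun i => ⟨e i, PUnit.unit⟩
      left_inv := fun p => by
        obtain ⟨k, u⟩ := p
        simp only [Equiv.apply_symm_apply]
      right_inv := fun i => Equiv.symm_apply_apply e i }
  exact FormalCoproduct.isoOfComponents e' fun _ => Iso.refl _

/-- **FrdI §0 p. 16: `C^⊥` is a category of finitely connected type.** [cite: MochizukiFrdI2008, §0 p.16] -/
theorem isOfFinitelyConnectedType_finiteCoproductCompletion :
    IsOfFinitelyConnectedType (FiniteCoproductCompletion.{w} C) where
  hasFiniteCoproducts := hasFiniteCoproducts_finiteCoproductCompletion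
  exists_cofan := exists_cofan_finiteCoproductCompletion
  bijective := fun {n} {F} c hc B hB => by
    obtain ⟨⟨i⟩, hs⟩ := (isConnectedObj_iff_finiteCoproductCompletion B).mp hB
    haveI : Unique B.obj.I := uniqueOfSubsingleton i
    haveI : ∀ k, Finite (F k).obj.I := fun k => (F k).property
    exact bijective_of_isColimit (P := finiteFormalCoproducts.{w} C)
      (show Finite (Σ k : Fin n, (F k).obj.I) from inferInstance) c hc B

end Literature.AlgebraicGeometry.Frobenioids
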